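import Literature.NumberTheory.Automorphic.Liu2021.Def412AdmissibleIffParity        -- ★ `isAdmissible_epsOf_iff_even` (Def. 4.12 ⟺ parity), `embedding_of_isReal_lt_zero_of_coe_eq_mul_self`
import Literature.AlgebraicGeometry.Liu2021.AdmissibleElement                       -- ★ `exists_isAdmissibleElement_of_cmType` (a μ-admissible element exists)
import Literature.NumberTheory.QuadraticForms.PrescribedNormClassesCM               -- ★ Hilbert reciprocity (O'Meara 71:18 ∕ 71:19)
import Literature.NumberTheory.Rogawski1990.CohomologicalFinComponentIsTheta        -- ★ the (C♭)-telescope vocabulary of the E3♭ ∕ E3♭∞ texts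
import Summits.HodgeConjecture.CorCM.B01.Transposition.Item6OmegaChiSplitting      -- ★ `isCompatible_chiSplittingLine` family (E3♭∞ text)
import Summits.HodgeConjecture.HodgeConjecture.Theorems.F0P2lE3FlatOfArch           -- ★ p821653 HR-a `even_ncard_locF_ne_one_add_card_neg`
import Summits.HodgeConjecture.HodgeConjecture.Theorems.F0P2fStubEPE3finGlobalEps   -- ★ EP `stubEP_holds` (an admissible collection is the collection of a global line)
import Summits.HodgeConjecture.HodgeConjecture.Theorems.F0P2sOccFlatAllOfThetaOccursIn -- ED. 3: ★ p844296 F0P2-p02 (g10): `stubOccFlatAll_of_thetaOccursInGen : ‹Θ-OCC-GEN› → ‹OCC♭∀›` (the OCC♭-GEN sub-line's §4 at Theorems level, over ★ p844131 p06 (g8) + ★ `F0P2cStubCI`)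
import Summits.HodgeConjecture.HodgeConjecture.Theorems.F0P2tThetaOccursInGenNeg        -- ED. 4: ★ p844949 F0P2-p06 (g8): Θ-OCC-GEN hypothesis-free (over ★ p844842 F0P2-p01 (g12))
import HarnessLib

/-!
# Crux `H413` · programme P2 · E3♭∞ and E3♭ ⟸ REL¹ — the E1 `F0_P2E3RelSign` §3 head re-hosted at Theorems level, hypothesis form (OCC♭∀ ★ and Θ-OCC-GEN ★ by name)

Cell hodgecm-mathlib (D-0151), FLOOR 0, crux item H413 = stmt-HodgeConjecture-24833; route support item `F0HdictE` = stmt-HodgeConjecture-27455 (programme P2).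
Author: desk F0P2-plan (g14), 2026-09-01 — REPORT-FIRST CANDIDATE (a P2 pen files it `--supports stmt-HodgeConjecture-24833 --as helper`; kernel lane).
THEOREMS ONLY (no `def`, no instance, no local attribute, no notation, no named fact of our own, no `sorry`); never imports a `Cruxes/…/Lines` module (O50-1) —
every statement text below is SLICED from the tree Lines bytes named per item (python, never retyped) and every in-house input is plugged BY NAME.
HONEST LABEL: HC_CM is proved only modulo the printed citations until rung 0 closes.  This file adds NO mathematics: it re-hosts, at `Theorems/` level and in HYPOTHESIS FORM, a kernel-checked Lines head, so that on the day
the hypothesis closes the fold is ONE token and NO Lines→Lines import is ever needed (the END-GAME fold chain of PLAN-P2 v16 §3).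

* `e3flatArch_of_relOne (hR : ‹REL¹›) : ‹E3♭∞›` — hypothesis = `F0P2E3RelSign.StubE3FlatRelParityOne` (tree `Cruxes/H413/Lines/F0_P2E3RelSign.lean` ED. 4 sha16
  f803733e6fbc6c36 :216 ff., the ONE registered `sorry` of E1, books #162′ REL¹ CLOSED-DERIVED over E2); conclusion = `F0P2E3RelSign.E3FlatArchTarget` (:170 ff.) =
  `F0P2E3ParityRecut.StubE3FlatArchParity` = the `hA` binder of ★ p821653 `F0P2lE3FlatOfArch.e3flat_of_arch` (ref1 r117∕r118 ties); proof = the body of E1's kernel-checked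
  head `e3flatArch_of_relSign` with OCC♭∀ ↦ ★ p844296 `F0P2sOccFlatAllOfThetaOccursIn.stubOccFlatAll_of_thetaOccursInGen` fed by ★ p844949
  `F0P2tThetaOccursInGenNeg.thetaOccursInGen` BY NAME; the elementary sign count `even_card_neg_mul_inv_add` is re-hosted verbatim (E1 :377, in-house, not importable from Lines).
* `e3flat_of_relOne (hR : ‹REL¹›) : ‹E3♭›` — conclusion = `F0P2E3ParityRecut.StubE3FlatAutomorphicParity` (tree `Cruxes/H413/Lines/F0_P2E3ParityRecut.lean` sha16 6c4b6abcfe6fb859 :def) =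
  (C)-line `F0_P2CohFinComponentIsThetaC.StubE3FlatAutomorphicParity` (:324) = the conclusion of ★ `e3flat_of_arch` = the `hE` binder of ★ p820501
  `F0P2kHdictEOfLetters.hdictE_of_PKPi_E3flat` (TEXT CERTIFICATE in ★ `F0P2kHdictEOfFourLetters`); proof = `e3flat_of_arch (e3flatArch_of_relOne hR)`.
  DAY-X USE: `e3flat_of_relOne (F0P2vRelOneOfRelSharpOne.relOne_of_relSharpOne relSharpOne_holds)` is E3♭ at Theorems level — the by-name folds of E3ParityRecut `stub_E3flatInf`
  (via `e3flatArch_of_relOne`) and of the (C)-line `stub_E3flat_automorphicParity`, and the `hE` input of ★ `hdictE_of_PKPi_E3flat` (END-GAME, PLAN-P2 v16 §3).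

## References
* [Rogawski1990] J. Rogawski, *Automorphic representations of unitary groups in three variables*, Ann. of Math. Stud. 123 (1990): Thm. 13.3.5, 13.3.6 (c), Prop. 13.1.3 (d), Thm. 14.6.4 p. 243, Prop. 15.2.1.
* [Rogawski1992] J. Rogawski, *The multiplicity formula for A-packets*, in: The zeta functions of Picard modular surfaces (1992), Thm. 1.1.
* [GelbartRogawski1991] S. Gelbart, J. Rogawski, *L-functions and Fourier–Jacobi coefficients for the unitary group U(3)*, Invent. Math. 105 (1991): Lem. 5.1.2 p. 466, Thm. 5.1.1.
* [Liu2021] Y. Liu, *Fourier–Jacobi cycles and arithmetic relative trace formula*, Camb. J. Math. 9 (2021): Prop. 4.13 (proof l. 2121–2149), Def. 4.11–4.12, Rem. 4.14.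
* [Omeara1963] O. T. O'Meara, *Introduction to quadratic forms* (1963), §71 Thm. 71:18 (Hilbert reciprocity).
-/

set_option autoImplicit false

-- the mandated namespace has the single-problem summit's repeated segment (`HodgeConjecture.HodgeConjecture`)
set_option linter.dupNamespace false

noncomputable section

namespace Summit.HodgeConjecture.HodgeConjecture.Cruxes.H413.F0P2vE3FlatOfRelOne

open scoped Matrix ComplexOrder
open NumberField NumberField.InfinitePlace IsDedekindDomain MeasureTheory
open Literature.NumberTheory Literature.NumberTheory.Automorphic Literature.NumberTheory.Automorphic.UnitaryGroup
open Literature.NumberTheory.Automorphic.UnitaryGroup.CotangentForms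
open Literature.NumberTheory.Automorphic.Liu2021 Literature.NumberTheory.Automorphic.Liu2021.AppendixC
open Literature.NumberTheory.Automorphic.Liu2021.Def411WeilCarriers
open Literature.NumberTheory.Automorphic.Liu2021.Def411WeilCarriersDoubling
open Literature.NumberTheory.Automorphic.IdeleClassGroup
open Literature.NumberTheory.GelbartRogawski1991 Literature.NumberTheory.GelbartRogawski1991.UnitaryDualPair
open Literature.NumberTheory.GelbartRogawski1991.UnitaryDualPair.WeilCoinv
open Literature.RepresentationTheory Literature.RepresentationTheory.Liu2021
open Literature.NumberTheory.Rogawski1990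
open Literature.NumberTheory.QuadraticForms
open Literature.AlgebraicGeometry.Liu2021 (IsAdmissibleElement exists_isAdmissibleElement_of_cmType)
open Summit.HodgeConjecture.CorCM
open Summit.HodgeConjecture.CorCM.Transposition

/-- **Sign bookkeeping at the real places of a totally real field.**  For units `a, b`: `#{w ∣ w(ab⁻¹) < 0} + (#{w ∣ w(a) < 0} + #{w ∣ w(b) < 0})`
is even — at each real place `w`, `w(ab⁻¹) = w(a)/w(b)` is negative iff exactly one of `w(a)`, `w(b)` is.  [in-house; elementary] -/
theorem even_card_neg_mul_inv_add (F : Type) [Field F] [NumberField F] [IsTotallyReal F] (a b : Fˣ) :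
    Even ((Finset.univ.filter fun w : InfinitePlace F =>
              InfinitePlace.embedding_of_isReal (IsTotallyReal.isReal w) ((a * b⁻¹ : Fˣ) : F) < 0).card +
      ((Finset.univ.filter fun w : InfinitePlace F =>
              InfinitePlace.embedding_of_isReal (IsTotallyReal.isReal w) (a : F) < 0).card +
        (Finset.univ.filter fun w : InfinitePlace F =>
              InfinitePlace.embedding_of_isReal (IsTotallyReal.isReal w) (b : F) < 0).card)) := by
  classical
  simp only [Finset.card_filter, ← Finset.sum_add_distrib]
  refine Finset.sum_induction _ Even (fun x y hx hy => hx.add hy) (even_iff_two_dvd.mpr (dvd_zero 2)) fun w _ => ?_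
  set f := InfinitePlace.embedding_of_isReal (IsTotallyReal.isReal w) with hf
  have ha : f (a : F) ≠ 0 := (map_ne_zero f).mpr a.ne_zero
  have hb : f (b : F) ≠ 0 := (map_ne_zero f).mpr b.ne_zero
  have hab : f ((a * b⁻¹ : Fˣ) : F) = f (a : F) / f (b : F) := by
    rw [Units.val_mul, Units.val_inv_eq_inv_val, map_mul, map_inv₀, div_eq_mul_inv]
  rcases lt_or_gt_of_ne ha with ha' | ha' <;> rcases lt_or_gt_of_ne hb with hb' | hb'
  · have hr : ¬ f ((a * b⁻¹ : Fˣ) : F) < 0 := by rw [hab]; exact not_lt.mpr (div_pos_of_neg_of_neg ha' hb').le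
    rw [if_neg hr, if_pos ha', if_pos hb']
    decide
  · have hr : f ((a * b⁻¹ : Fˣ) : F) < 0 := by rw [hab]; exact div_neg_of_neg_of_pos ha' hb'
    rw [if_pos hr, if_pos ha', if_neg (not_lt.mpr hb'.le)]
    decide
  · have hr : f ((a * b⁻¹ : Fˣ) : F) < 0 := by rw [hab]; exact div_neg_of_pos_of_neg ha' hb'
    rw [if_pos hr, if_neg (not_lt.mpr ha'.le), if_pos hb']
    decide
  · have hr : ¬ f ((a * b⁻¹ : Fˣ) : F) < 0 := by rw [hab]; exact not_lt.mpr (div_pos ha' hb').le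
    rw [if_neg hr, if_neg (not_lt.mpr ha'.le), if_neg (not_lt.mpr hb'.le)]
    decide

set_option synthInstance.maxHeartbeats 400000 in
set_option maxHeartbeats 16000000 in
/-- **E3♭∞ ⟸ REL¹** (E1 `e3flatArch_of_relSign` re-hosted; OCC♭∀ ★ over Θ-OCC-GEN ★ by name): an admissible reference collection `locF θ` (★ `exists_isAdmissibleElement_of_cmType`,
★ EP `stubEP_holds`); OCC♭∀ at the target's `μA` gives the calibrating cotangent `P′` at the line `θ`; REL¹ between `P` and `P′`; `locF` a homomorphism; HR-a ★ twice;
[Liu2021, Def. 4.12] ⟺ parity ★ once; the real-place sign count; parity algebra.  [cite: Liu2021, Prop. 4.13 (proof l. 2131–2149), Def. 4.12, Rem. 4.14]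
[cite: Rogawski1990, §14.6 (14.6.3), Thm 14.6.4] [cite: Omeara1963, §71 Thm. 71:18] -/
theorem e3flatArch_of_relOne
    (hR :
      ∀ (L : Type) [Field L] [NumberField L] [IsCMField L] (ι : L →+* ℂ) (H : Matrix (Fin 3) (Fin 3) L) (T : GL (Fin 3) ℂ)
        (hT : (T : Matrix (Fin 3) (Fin 3) ℂ)ᴴ * H.map ι * (T : Matrix (Fin 3) (Fin 3) ℂ) = Literature.Geometry.ComplexHyperbolic.BallModel.J),
        (∀ τ' : L →+* ℂ, InfinitePlace.mk τ' ≠ InfinitePlace.mk ι → (H.map τ').PosDef) → 2 ≤ Module.finrank ℚ ↥(maximalRealSubfield L) →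
        ∀ {n' : ℕ} (e₁ : Fin 3 × Fin 1 ≃ Fin n') (dV : Fin 3 → L) (hdV : ∀ i, IsCMField.complexConj L (dV i) = dV i)
          (hdV0 : ∀ i, dV i ≠ 0) (g : GL (Fin 3) L)
          (hg : ((g : Matrix (Fin 3) (Fin 3) L).map (cmConjRingHom L))ᵀ * H * (g : Matrix (Fin 3) (Fin 3) L) = Matrix.diagonal dV)
          (ιV : finAdelic (↥(maximalRealSubfield L)) L (IsCMField.complexConj L) 3 H →*
              finAdelic (↥(maximalRealSubfield L)) L (IsCMField.complexConj L) 3 (Matrix.diagonal dV)),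
            (∀ k, ((ιV k : finAdelic (↥(maximalRealSubfield L)) L (IsCMField.complexConj L) 3 (Matrix.diagonal dV)) :
                GL (Fin 3) (FiniteAdeleRing (𝓞 L) L)) =
              (toFinAdeleGL L 3 g)⁻¹ * (k : GL (Fin 3) (FiniteAdeleRing (𝓞 L) L)) * toFinAdeleGL L 3 g) →
            ∀ (μA : Measure (adelicGroupData (↥(maximalRealSubfield L)) L (IsCMField.complexConj L) 3 H).automorphicQuotient)
              [(adelicGroupData (↥(maximalRealSubfield L)) L (IsCMField.complexConj L) 3 H).IsAutomorphicMeasure μA]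
              (P : DiscreteAutomorphicRep (adelicGroupData (↥(maximalRealSubfield L)) L (IsCMField.complexConj L) 3 H) μA)
              (P' : DiscreteAutomorphicRep (adelicGroupData (↥(maximalRealSubfield L)) L (IsCMField.complexConj L) 3 H) μA),
              (P.IsHolCotangentAt (cmArchSection L ι H T hT) (cmCompactFactor L ι H T hT) ∨ P.IsAntiholCotangentAt (cmArchSection L ι H T hT) (cmCompactFactor L ι H T hT)) →
              (P'.IsHolCotangentAt (cmArchSection L ι H T hT) (cmCompactFactor L ι H T hT) ∨ P'.IsAntiholCotangentAt (cmArchSection L ι H T hT) (cmCompactFactor L ι H T hT)) →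
                ∀ (μ : Literature.NumberTheory.Automorphic.IdeleClassGroup L →ₜ* Circle) (hμ : IsConjugateSymplectic L μ), HasWeight L μ 1 →
                  ∀ (a a' : (↥(maximalRealSubfield L))ˣ) (χ : Chi (↥(maximalRealSubfield L)) L (IsCMField.complexConj L)),
                    P.HasFinComponent
                      (rhoAtLine (↥(maximalRealSubfield L)) L (IsCMField.complexConj L) 3 e₁ (Matrix.diagonal dV)
                        (complexConj_imagUnit L) (imagUnit_ne_zero L) (imagUnit_mul_self L) (realDiagonal_isSymm L dV hdV)
                        (isUnit_det_realDiagonal L dV hdV hdV0) (realDiagonal_map L dV hdV).symm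
                        (fun a => isCompatible_chiSplittingLine L e₁ dV hdV hdV0 (toHeckeCharacter L μ)
                          (isUnitary_toHeckeCharacter L μ) ((isOscillatorChar_toHeckeCharacter_iff μ).mpr hμ)
                          (TW (↥(maximalRealSubfield L)) a) (isSymm_TW (↥(maximalRealSubfield L)) a)
                          (isUnit_det_TW (↥(maximalRealSubfield L)) a) (JW (↥(maximalRealSubfield L)) L a)
                          (JW_eq (↥(maximalRealSubfield L)) L a)) ιV a χ) →
                    P'.HasFinComponent
                      (rhoAtLine (↥(maximalRealSubfield L)) L (IsCMField.complexConj L) 3 e₁ (Matrix.diagonal dV)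
                        (complexConj_imagUnit L) (imagUnit_ne_zero L) (imagUnit_mul_self L) (realDiagonal_isSymm L dV hdV)
                        (isUnit_det_realDiagonal L dV hdV hdV0) (realDiagonal_map L dV hdV).symm
                        (fun a => isCompatible_chiSplittingLine L e₁ dV hdV hdV0 (toHeckeCharacter L μ)
                          (isUnitary_toHeckeCharacter L μ) ((isOscillatorChar_toHeckeCharacter_iff μ).mpr hμ)
                          (TW (↥(maximalRealSubfield L)) a) (isSymm_TW (↥(maximalRealSubfield L)) a)
                          (isUnit_det_TW (↥(maximalRealSubfield L)) a) (JW (↥(maximalRealSubfield L)) L a)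
                          (JW_eq (↥(maximalRealSubfield L)) L a)) ιV a' χ) →
                      Even ({v : HeightOneSpectrum (𝓞 ↥(maximalRealSubfield L)) |
                              locF (↥(maximalRealSubfield L)) (imagUnitSq L) a v ≠ locF (↥(maximalRealSubfield L)) (imagUnitSq L) a' v}.ncard)
    ) :
    ∀ (L : Type) [Field L] [NumberField L] [IsCMField L] (ι : L →+* ℂ) (H : Matrix (Fin 3) (Fin 3) L) (T : GL (Fin 3) ℂ)
      (hT : (T : Matrix (Fin 3) (Fin 3) ℂ)ᴴ * H.map ι * (T : Matrix (Fin 3) (Fin 3) ℂ) = Literature.Geometry.ComplexHyperbolic.BallModel.J),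
      (∀ τ' : L →+* ℂ, InfinitePlace.mk τ' ≠ InfinitePlace.mk ι → (H.map τ').PosDef) → 2 ≤ Module.finrank ℚ ↥(maximalRealSubfield L) →
      ∀ {n' : ℕ} (e₁ : Fin 3 × Fin 1 ≃ Fin n') (dV : Fin 3 → L) (hdV : ∀ i, IsCMField.complexConj L (dV i) = dV i)
        (hdV0 : ∀ i, dV i ≠ 0) (g : GL (Fin 3) L)
        (hg : ((g : Matrix (Fin 3) (Fin 3) L).map (cmConjRingHom L))ᵀ * H * (g : Matrix (Fin 3) (Fin 3) L) = Matrix.diagonal dV)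
        (ιV : finAdelic (↥(maximalRealSubfield L)) L (IsCMField.complexConj L) 3 H →*
            finAdelic (↥(maximalRealSubfield L)) L (IsCMField.complexConj L) 3 (Matrix.diagonal dV)),
          (∀ k, ((ιV k : finAdelic (↥(maximalRealSubfield L)) L (IsCMField.complexConj L) 3 (Matrix.diagonal dV)) :
              GL (Fin 3) (FiniteAdeleRing (𝓞 L) L)) =
            (toFinAdeleGL L 3 g)⁻¹ * (k : GL (Fin 3) (FiniteAdeleRing (𝓞 L) L)) * toFinAdeleGL L 3 g) →
          ∀ (μA : Measure (adelicGroupData (↥(maximalRealSubfield L)) L (IsCMField.complexConj L) 3 H).automorphicQuotient)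
            [(adelicGroupData (↥(maximalRealSubfield L)) L (IsCMField.complexConj L) 3 H).IsAutomorphicMeasure μA],
            ∀ P : DiscreteAutomorphicRep (adelicGroupData (↥(maximalRealSubfield L)) L (IsCMField.complexConj L) 3 H) μA,
              (P.IsHolCotangentAt (cmArchSection L ι H T hT) (cmCompactFactor L ι H T hT) ∨
                P.IsAntiholCotangentAt (cmArchSection L ι H T hT) (cmCompactFactor L ι H T hT)) →
              ∀ (μ : Literature.NumberTheory.Automorphic.IdeleClassGroup L →ₜ* Circle) (hμ : IsConjugateSymplectic L μ), HasWeight L μ 1 →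
                ∀ (a : (↥(maximalRealSubfield L))ˣ) (χ : Chi (↥(maximalRealSubfield L)) L (IsCMField.complexConj L)),
                  P.HasFinComponent
                    (rhoAtLine (↥(maximalRealSubfield L)) L (IsCMField.complexConj L) 3 e₁ (Matrix.diagonal dV)
                      (complexConj_imagUnit L) (imagUnit_ne_zero L) (imagUnit_mul_self L) (realDiagonal_isSymm L dV hdV)
                      (isUnit_det_realDiagonal L dV hdV hdV0) (realDiagonal_map L dV hdV).symm
                      (fun a => isCompatible_chiSplittingLine L e₁ dV hdV hdV0 (toHeckeCharacter L μ)
                        (isUnitary_toHeckeCharacter L μ) ((isOscillatorChar_toHeckeCharacter_iff μ).mpr hμ)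
                        (TW (↥(maximalRealSubfield L)) a) (isSymm_TW (↥(maximalRealSubfield L)) a)
                        (isUnit_det_TW (↥(maximalRealSubfield L)) a) (JW (↥(maximalRealSubfield L)) L a)
                        (JW_eq (↥(maximalRealSubfield L)) L a)) ιV a χ) →
                    Even ((Finset.univ.filter fun w : InfinitePlace ↥(maximalRealSubfield L) =>
                              InfinitePlace.embedding_of_isReal (IsTotallyReal.isReal w) (a : ↥(maximalRealSubfield L)) < 0).card +
                      {φ : L →+* ℂ | φ ∈ hμ.cmType.1 ∧ 0 < (φ (2 * imagUnit L)⁻¹).im}.ncard) := by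
  intro L _ _ _ ι H T hT hpos h2 n' e₁ dV hdV hdV0 g hg ιV hιV μA _ P hP μ hμ hw a χ hfc
  classical
  -- (1) a `μ`-admissible reference collection `locF θ` ([Liu2021, Def. 4.12]: an admissible `e` exists; ★ EP: its collection is that of a global line `θ`)
  obtain ⟨e, he⟩ := exists_isAdmissibleElement_of_cmType hμ.cmType.1 hμ.cmType.2
  obtain ⟨θ, hθ⟩ := F0P2fStubEPE3finGlobalEps.stubEP_holds L
    (epsOf (↥(maximalRealSubfield L)) (imagUnitSq L) L (2 * imagUnit L)⁻¹ e) ⟨e, he.1, he.2.1, rfl⟩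
  have hadm : ∃ e : L, IsAdmissibleElement L hμ.cmType.1 e ∧
      epsOf (↥(maximalRealSubfield L)) (imagUnitSq L) L (2 * imagUnit L)⁻¹ e =
        locF (↥(maximalRealSubfield L)) (imagUnitSq L) θ := ⟨e, he, hθ.symm⟩
  -- (2) OCC♭∀ at the target's measure `μA`: the calibrating cotangent member `P'` at the line `θ`, on `μA` (ED. 2)
  obtain ⟨P', hP', hfc'⟩ := Summit.HodgeConjecture.HodgeConjecture.Cruxes.H413.F0P2sOccFlatAllOfThetaOccursIn.stubOccFlatAll_of_thetaOccursInGen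
    Summit.HodgeConjecture.HodgeConjecture.Cruxes.H413.F0P2tThetaOccursInGenNeg.thetaOccursInGen L ι H T hT hpos h2 e₁ dV hdV hdV0 g hg ιV hιV μA μ hμ hw θ χ hadm
  -- (3) REL¹ between `P` (line `a`) and `P'` (line `θ`), both on `μA` (ED. 2)
  have hrel := hR L ι H T hT hpos h2 e₁ dV hdV hdV0 g hg ιV hιV μA P P' hP hP' μ hμ hw a θ χ hfc hfc'
  -- (4) `locF` is a homomorphism: the places where `[a]_v ≠ [θ]_v` are the places where `[aθ⁻¹]_v ≠ 1`
  have hset : {v : HeightOneSpectrum (𝓞 ↥(maximalRealSubfield L)) |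
        locF (↥(maximalRealSubfield L)) (imagUnitSq L) a v ≠ locF (↥(maximalRealSubfield L)) (imagUnitSq L) θ v} =
      {v : HeightOneSpectrum (𝓞 ↥(maximalRealSubfield L)) |
        locF (↥(maximalRealSubfield L)) (imagUnitSq L) (a * θ⁻¹) v ≠ 1} := by
    ext v
    simp only [Set.mem_setOf_eq, map_mul, map_inv, Pi.mul_apply, Pi.inv_apply, ne_eq, mul_inv_eq_one]
  rw [hset] at hrel
  -- (5) Hilbert reciprocity HR-a ★ at `aθ⁻¹` and at `θ`; [Liu2021, Def. 4.12] ⟺ parity ★ at `θ`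
  have h1 := F0P2lE3FlatOfArch.even_ncard_locF_ne_one_add_card_neg L (a * θ⁻¹)
  have h2' := F0P2lE3FlatOfArch.even_ncard_locF_ne_one_add_card_neg L θ
  have hδ : IsCMField.complexConj L (2 * imagUnit L)⁻¹ = -(2 * imagUnit L)⁻¹ := by
    rw [map_inv₀, map_mul, map_ofNat, complexConj_imagUnit, mul_neg, inv_neg]
  have hδ0 : (2 * imagUnit L)⁻¹ ≠ 0 := inv_ne_zero (mul_ne_zero two_ne_zero (imagUnit_ne_zero L))
  have hd0 : imagUnitSq L ≠ 0 := ne_zero_of_coe_eq_mul_self (imagUnit_ne_zero L) (imagUnit_mul_self L).symm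
  have hdneg : ∀ (w : InfinitePlace ↥(maximalRealSubfield L)) (hw : w.IsReal),
      InfinitePlace.embedding_of_isReal hw (imagUnitSq L) < 0 :=
    embedding_of_isReal_lt_zero_of_coe_eq_mul_self (complexConj_imagUnit L) (imagUnit_ne_zero L) (imagUnit_mul_self L).symm
  have h3 := ((isAdmissible_epsOf_iff_even L hμ.cmType hδ hδ0 (imagUnitSq L) hd0 hdneg
    (locF (↥(maximalRealSubfield L)) (imagUnitSq L) θ)).mp hadm).2
  -- (6) the sign count at the real places: `#neg(aθ⁻¹) + (#neg a + #neg θ)` is even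
  have h4 := even_card_neg_mul_inv_add (↥(maximalRealSubfield L)) a θ
  -- (7) parity algebra: hrel `Even R`; h1 `Even (R + Nq)`; h2' `Even (Fθ + Nθ)`; h3 `Even (Fθ + c)`; h4 `Even (Nq + (Na + Nθ))` ⊢ `Even (Na + c)`
  have eNq := (Nat.even_add.mp h1).mp hrel
  have eNN := (Nat.even_add.mp h4).mp eNq
  exact Nat.even_add.mpr ((Nat.even_add.mp eNN).trans ((Nat.even_add.mp h2').symm.trans (Nat.even_add.mp h3)))

set_option synthInstance.maxHeartbeats 400000 in
set_option maxHeartbeats 16000000 in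
/-- **E3♭ ⟸ REL¹** — ★ p821653 `F0P2lE3FlatOfArch.e3flat_of_arch` (E3♭∞ → E3♭, Hilbert reciprocity HR-a) after `e3flatArch_of_relOne`.  Conclusion = the E3♭ letter text
(`F0P2E3ParityRecut.StubE3FlatAutomorphicParity` ∕ (C)-line :324 ∕ ★ `hdictE_of_PKPi_E3flat`'s `hE`, VERBATIM).  [cite: Rogawski1992, Thm 1.1] [cite: Liu2021, Prop. 4.13, Rem. 4.14] -/
theorem e3flat_of_relOne
    (hR :
      ∀ (L : Type) [Field L] [NumberField L] [IsCMField L] (ι : L →+* ℂ) (H : Matrix (Fin 3) (Fin 3) L) (T : GL (Fin 3) ℂ)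
        (hT : (T : Matrix (Fin 3) (Fin 3) ℂ)ᴴ * H.map ι * (T : Matrix (Fin 3) (Fin 3) ℂ) = Literature.Geometry.ComplexHyperbolic.BallModel.J),
        (∀ τ' : L →+* ℂ, InfinitePlace.mk τ' ≠ InfinitePlace.mk ι → (H.map τ').PosDef) → 2 ≤ Module.finrank ℚ ↥(maximalRealSubfield L) →
        ∀ {n' : ℕ} (e₁ : Fin 3 × Fin 1 ≃ Fin n') (dV : Fin 3 → L) (hdV : ∀ i, IsCMField.complexConj L (dV i) = dV i)
          (hdV0 : ∀ i, dV i ≠ 0) (g : GL (Fin 3) L)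
          (hg : ((g : Matrix (Fin 3) (Fin 3) L).map (cmConjRingHom L))ᵀ * H * (g : Matrix (Fin 3) (Fin 3) L) = Matrix.diagonal dV)
          (ιV : finAdelic (↥(maximalRealSubfield L)) L (IsCMField.complexConj L) 3 H →*
              finAdelic (↥(maximalRealSubfield L)) L (IsCMField.complexConj L) 3 (Matrix.diagonal dV)),
            (∀ k, ((ιV k : finAdelic (↥(maximalRealSubfield L)) L (IsCMField.complexConj L) 3 (Matrix.diagonal dV)) :
                GL (Fin 3) (FiniteAdeleRing (𝓞 L) L)) =
              (toFinAdeleGL L 3 g)⁻¹ * (k : GL (Fin 3) (FiniteAdeleRing (𝓞 L) L)) * toFinAdeleGL L 3 g) →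
            ∀ (μA : Measure (adelicGroupData (↥(maximalRealSubfield L)) L (IsCMField.complexConj L) 3 H).automorphicQuotient)
              [(adelicGroupData (↥(maximalRealSubfield L)) L (IsCMField.complexConj L) 3 H).IsAutomorphicMeasure μA]
              (P : DiscreteAutomorphicRep (adelicGroupData (↥(maximalRealSubfield L)) L (IsCMField.complexConj L) 3 H) μA)
              (P' : DiscreteAutomorphicRep (adelicGroupData (↥(maximalRealSubfield L)) L (IsCMField.complexConj L) 3 H) μA),
              (P.IsHolCotangentAt (cmArchSection L ι H T hT) (cmCompactFactor L ι H T hT) ∨ P.IsAntiholCotangentAt (cmArchSection L ι H T hT) (cmCompactFactor L ι H T hT)) →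
              (P'.IsHolCotangentAt (cmArchSection L ι H T hT) (cmCompactFactor L ι H T hT) ∨ P'.IsAntiholCotangentAt (cmArchSection L ι H T hT) (cmCompactFactor L ι H T hT)) →
                ∀ (μ : Literature.NumberTheory.Automorphic.IdeleClassGroup L →ₜ* Circle) (hμ : IsConjugateSymplectic L μ), HasWeight L μ 1 →
                  ∀ (a a' : (↥(maximalRealSubfield L))ˣ) (χ : Chi (↥(maximalRealSubfield L)) L (IsCMField.complexConj L)),
                    P.HasFinComponent
                      (rhoAtLine (↥(maximalRealSubfield L)) L (IsCMField.complexConj L) 3 e₁ (Matrix.diagonal dV)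
                        (complexConj_imagUnit L) (imagUnit_ne_zero L) (imagUnit_mul_self L) (realDiagonal_isSymm L dV hdV)
                        (isUnit_det_realDiagonal L dV hdV hdV0) (realDiagonal_map L dV hdV).symm
                        (fun a => isCompatible_chiSplittingLine L e₁ dV hdV hdV0 (toHeckeCharacter L μ)
                          (isUnitary_toHeckeCharacter L μ) ((isOscillatorChar_toHeckeCharacter_iff μ).mpr hμ)
                          (TW (↥(maximalRealSubfield L)) a) (isSymm_TW (↥(maximalRealSubfield L)) a)
                          (isUnit_det_TW (↥(maximalRealSubfield L)) a) (JW (↥(maximalRealSubfield L)) L a)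
                          (JW_eq (↥(maximalRealSubfield L)) L a)) ιV a χ) →
                    P'.HasFinComponent
                      (rhoAtLine (↥(maximalRealSubfield L)) L (IsCMField.complexConj L) 3 e₁ (Matrix.diagonal dV)
                        (complexConj_imagUnit L) (imagUnit_ne_zero L) (imagUnit_mul_self L) (realDiagonal_isSymm L dV hdV)
                        (isUnit_det_realDiagonal L dV hdV hdV0) (realDiagonal_map L dV hdV).symm
                        (fun a => isCompatible_chiSplittingLine L e₁ dV hdV hdV0 (toHeckeCharacter L μ)
                          (isUnitary_toHeckeCharacter L μ) ((isOscillatorChar_toHeckeCharacter_iff μ).mpr hμ)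
                          (TW (↥(maximalRealSubfield L)) a) (isSymm_TW (↥(maximalRealSubfield L)) a)
                          (isUnit_det_TW (↥(maximalRealSubfield L)) a) (JW (↥(maximalRealSubfield L)) L a)
                          (JW_eq (↥(maximalRealSubfield L)) L a)) ιV a' χ) →
                      Even ({v : HeightOneSpectrum (𝓞 ↥(maximalRealSubfield L)) |
                              locF (↥(maximalRealSubfield L)) (imagUnitSq L) a v ≠ locF (↥(maximalRealSubfield L)) (imagUnitSq L) a' v}.ncard)
    ) :
    ∀ (L : Type) [Field L] [NumberField L] [IsCMField L] (ι : L →+* ℂ) (H : Matrix (Fin 3) (Fin 3) L) (T : GL (Fin 3) ℂ)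
      (hT : (T : Matrix (Fin 3) (Fin 3) ℂ)ᴴ * H.map ι * (T : Matrix (Fin 3) (Fin 3) ℂ) = Literature.Geometry.ComplexHyperbolic.BallModel.J),
      (∀ τ' : L →+* ℂ, InfinitePlace.mk τ' ≠ InfinitePlace.mk ι → (H.map τ').PosDef) → 2 ≤ Module.finrank ℚ ↥(maximalRealSubfield L) →
      ∀ {n' : ℕ} (e₁ : Fin 3 × Fin 1 ≃ Fin n') (dV : Fin 3 → L) (hdV : ∀ i, IsCMField.complexConj L (dV i) = dV i)
        (hdV0 : ∀ i, dV i ≠ 0) (g : GL (Fin 3) L)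
        (hg : ((g : Matrix (Fin 3) (Fin 3) L).map (cmConjRingHom L))ᵀ * H * (g : Matrix (Fin 3) (Fin 3) L) = Matrix.diagonal dV)
        (ιV : finAdelic (↥(maximalRealSubfield L)) L (IsCMField.complexConj L) 3 H →*
            finAdelic (↥(maximalRealSubfield L)) L (IsCMField.complexConj L) 3 (Matrix.diagonal dV)),
          (∀ k, ((ιV k : finAdelic (↥(maximalRealSubfield L)) L (IsCMField.complexConj L) 3 (Matrix.diagonal dV)) :
              GL (Fin 3) (FiniteAdeleRing (𝓞 L) L)) =
            (toFinAdeleGL L 3 g)⁻¹ * (k : GL (Fin 3) (FiniteAdeleRing (𝓞 L) L)) * toFinAdeleGL L 3 g) →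
          ∀ (μA : Measure (adelicGroupData (↥(maximalRealSubfield L)) L (IsCMField.complexConj L) 3 H).automorphicQuotient)
            [(adelicGroupData (↥(maximalRealSubfield L)) L (IsCMField.complexConj L) 3 H).IsAutomorphicMeasure μA],
            ∀ P : DiscreteAutomorphicRep (adelicGroupData (↥(maximalRealSubfield L)) L (IsCMField.complexConj L) 3 H) μA,
              (P.IsHolCotangentAt (cmArchSection L ι H T hT) (cmCompactFactor L ι H T hT) ∨
                P.IsAntiholCotangentAt (cmArchSection L ι H T hT) (cmCompactFactor L ι H T hT)) →
              ∀ (μ : Literature.NumberTheory.Automorphic.IdeleClassGroup L →ₜ* Circle) (hμ : IsConjugateSymplectic L μ), HasWeight L μ 1 →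
                ∀ (a : (↥(maximalRealSubfield L))ˣ) (χ : Chi (↥(maximalRealSubfield L)) L (IsCMField.complexConj L)),
                  P.HasFinComponent
                    (rhoAtLine (↥(maximalRealSubfield L)) L (IsCMField.complexConj L) 3 e₁ (Matrix.diagonal dV)
                      (complexConj_imagUnit L) (imagUnit_ne_zero L) (imagUnit_mul_self L) (realDiagonal_isSymm L dV hdV)
                      (isUnit_det_realDiagonal L dV hdV hdV0) (realDiagonal_map L dV hdV).symm
                      (fun a => isCompatible_chiSplittingLine L e₁ dV hdV hdV0 (toHeckeCharacter L μ)
                        (isUnitary_toHeckeCharacter L μ) ((isOscillatorChar_toHeckeCharacter_iff μ).mpr hμ)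
                        (TW (↥(maximalRealSubfield L)) a) (isSymm_TW (↥(maximalRealSubfield L)) a)
                        (isUnit_det_TW (↥(maximalRealSubfield L)) a) (JW (↥(maximalRealSubfield L)) L a)
                        (JW_eq (↥(maximalRealSubfield L)) L a)) ιV a χ) →
                    Even ({v : HeightOneSpectrum (𝓞 ↥(maximalRealSubfield L)) |
                            locF (↥(maximalRealSubfield L)) (imagUnitSq L) a v ≠ 1}.ncard +
                      {φ : L →+* ℂ | φ ∈ hμ.cmType.1 ∧ 0 < (φ (2 * imagUnit L)⁻¹).im}.ncard) :=
  Summit.HodgeConjecture.HodgeConjecture.Cruxes.H413.F0P2lE3FlatOfArch.e3flat_of_arch (e3flatArch_of_relOne hR)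

end Summit.HodgeConjecture.HodgeConjecture.Cruxes.H413.F0P2vE3FlatOfRelOne

end
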